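import Summits.ValiantsHypothesis.ValiantsHypothesis.Theorems.LacunarySymmetroidMatrixDescartesDoorA26WallBubblingExpSumLocalSigns

/-!
# `DoorA26` / line `wall_bubbling` — LAGUERRE–DESCARTES WITH MULTIPLICITY for real exponential sums (zeros counted with their orders)

HONEST FRAMING.  Object-search cell `pub-symmetroid`, crux `Theses.LacunarySymmetroid.DoorA26` (stmt-ValiantsHypothesis-19979; OPEN, typed,
never asserted).  W2 seat val-sym-door-p1 g19, file #64; def-free helper for obligation (R) of `Cruxes/DoorA26/Lines/wall_bubbling.lean` (the
single-cluster front-end needs EXACT ORDERS of the limit zeros; the order-3 lift needs the Hermite budget at the triple zero) and for the line lead's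
`RolleWindowLemma` («Rolle with multiplicity», `Lines/wall_bubbling_EndDoor.lean`).  Imports #56 `…ExpSumLocalSigns` (for #50's `iteratedDeriv_expSum`
and `Bubbling.rolle_count_fin` / `hasDerivAt_expSum`).  The tree had the DISTINCT-zero count (`Census.RealExp.expSum_zero_or_ncard_le`) and the order-≤-2
case (#59 `card_zeros_add_card_double_le`); this is the general statement.

WHAT IS HERE.  `iteratedDeriv_expSum_shift` (`(f′ − x₀f)^{(k)} = f^{(k+1)} − x₀ f^{(k)}` for `f = expSum a x`, itself the exponential sum with
coefficients `a_i(x_i − x₀)`), ★ `sum_order_le_of_expSum`: a `(K+1)`-term sum with pairwise distinct exponents and `a ≠ 0`, vanishing to order `≥ m(z)`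
(`iteratedDeriv k f z = 0` for `k < m z`) at the points of a finite set `Z`, has `Σ_{z∈Z} m(z) ≤ K` — induction on `K`: `g = f′ − x₀ f` drops the term
`x₀`, keeps order `≥ m(z) − 1` at each zero and gains a Rolle point of `e^{−x₀t}f` strictly inside each gap; `sum_orderEmbOfFin_real`; ★ `sum_order_lt_card_classes`:
the same with COINCIDENT exponents allowed — `Σ m(z) + 1 ≤ #(distinct exponents)` as soon as some exponent class has a non-zero coefficient sum
(`Bubbling.expSum_eq_sum_classes`).  For the `(2,6)` pencil determinant (#50 `det_expPencil_eq_expSum_fun`, ≤ 21 classes) this is «total multiplicity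
≤ 20».  Nothing here bears on `DoorA26`, `DoorA34`, (W)/(M)/(R), `MatrixDescartes` (18050) or `VP ≠ VNP`; registers unchanged.

[folklore] Laguerre 1898; Pólya–Szegő, *Aufgaben* V §1 (Descartes' rule for exponential sums with multiplicity).  [this work] the packaging.
-/

set_option linter.dupNamespace false

namespace Summit.ValiantsHypothesis.ValiantsHypothesis.Theorems.LacunarySymmetroidMatrixDescartes.WallBubbling

open Finset Filter Topology
open Bubbling (expSum hasDerivAt_expSum)

/-- The operator `f ↦ f′ − x₀ f` on an exponential sum: again an exponential sum, coefficients `a_i (x_i − x₀)`; its `k`-th derivative at a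
point is `f^{(k+1)} − x₀ f^{(k)}`. [folklore] -/
theorem iteratedDeriv_expSum_shift {ι : Type*} [Fintype ι] (a x : ι → ℝ) (x₀ : ℝ) (k : ℕ) (t : ℝ) :
    iteratedDeriv k (expSum (fun i => a i * (x i - x₀)) x) t =
      iteratedDeriv (k + 1) (expSum a x) t - x₀ * iteratedDeriv k (expSum a x) t := by
  rw [iteratedDeriv_expSum, iteratedDeriv_expSum, iteratedDeriv_expSum]
  simp only [expSum, Finset.mul_sum, ← Finset.sum_sub_distrib]
  refine Finset.sum_congr rfl fun i _ => by ring

/-- **LAGUERRE–DESCARTES WITH MULTIPLICITY.**  A real exponential sum with `K + 1` terms, pairwise distinct exponents and not all coefficients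
zero, has total vanishing order at most `K` on any finite set: if `f^{(k)}(z) = 0` for all `k < m(z)`, `z ∈ Z`, then `Σ_{z ∈ Z} m(z) ≤ K`.  Induction:
`g = f′ − x₀ f` has `K` terms, order `≥ m(z) − 1` at each `z`, and one more zero strictly inside each gap between consecutive zeros of `f` (Rolle for
`e^{−x₀t} f`). [folklore] (Laguerre 1898; Pólya–Szegő V §1) -/
theorem sum_order_le_of_expSum : ∀ (K : ℕ) (x : Fin (K + 1) → ℝ) (_hx : Function.Injective x) (a : Fin (K + 1) → ℝ)
    (_ha : a ≠ 0) (Z : Finset ℝ) (m : ℝ → ℕ)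
    (_hvan : ∀ z ∈ Z, ∀ k < m z, iteratedDeriv k (expSum a x) z = 0), ∑ z ∈ Z, m z ≤ K := by
  intro K
  induction K with
  | zero =>
    intro x hx a ha Z m hvan
    -- one term: `a 0 e^{x 0 t}` never vanishes, so every `m z = 0`
    have ha0 : a 0 ≠ 0 := fun h => ha (funext fun i => by
      rw [show i = 0 from Fin.ext (by have := i.isLt; omega)]; exact h)
    have hm : ∀ z ∈ Z, m z = 0 := by
      intro z hz
      by_contra hne
      have := hvan z hz 0 (Nat.pos_of_ne_zero hne)
      rw [iteratedDeriv_zero] at this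
      simp only [expSum, Fin.sum_univ_succ, Fin.sum_univ_zero, add_zero] at this
      rcases mul_eq_zero.1 this with h | h
      · exact ha0 h
      · exact (Real.exp_pos _).ne' h
    rw [Finset.sum_eq_zero hm]
  | succ K ih =>
    intro x hx a ha Z m hvan
    classical
    -- restrict to the genuine zeros (`m z ≥ 1`)
    set Zp : Finset ℝ := Z.filter fun z => 1 ≤ m z with hZp
    have hsum : ∑ z ∈ Z, m z = ∑ z ∈ Zp, m z := by
      rw [hZp, Finset.sum_filter]
      refine Finset.sum_congr rfl fun z _ => ?_
      split_ifs with h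
      · rfl
      · omega
    rw [hsum]
    have hvanp : ∀ z ∈ Zp, ∀ k < m z, iteratedDeriv k (expSum a x) z = 0 := fun z hz => hvan z (Finset.mem_filter.1 hz).1
    have hposp : ∀ z ∈ Zp, 1 ≤ m z := fun z hz => (Finset.mem_filter.1 hz).2
    set f := expSum a x with hf
    set x₀ := x 0 with hx₀
    -- the shifted derivative `g = f′ − x₀ f` as a `K + 1`-term sum on the other exponents
    set a' : Fin (K + 1) → ℝ := fun i => a i.succ * (x i.succ - x₀) with ha'
    set x' : Fin (K + 1) → ℝ := fun i => x i.succ with hx'def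
    have hx' : Function.Injective x' := fun i j h => Fin.succ_injective _ (hx h)
    set g := expSum (fun i => a i * (x i - x₀)) x with hg
    have hgx' : g = expSum a' x' := by
      funext t
      rw [hg, ha', hx'def]
      simp only [expSum]
      rw [Fin.sum_univ_succ, hx₀, sub_self, mul_zero, zero_mul, zero_add]
    by_cases hZe : Zp = ∅
    · rw [hZe]; simp
    obtain ⟨n, hn⟩ : ∃ n, Zp.card = n + 1 := ⟨Zp.card - 1, by
      have := Finset.card_pos.2 (Finset.nonempty_iff_ne_empty.2 hZe); omega⟩
    by_cases ha'0 : a' = 0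
    · -- all other coefficients vanish: `f = a 0 e^{x₀ t}` has no zeros, so `Zp = ∅`
      exfalso
      have hcoef : ∀ i : Fin (K + 1), a i.succ = 0 := by
        intro i
        have h : a i.succ * (x i.succ - x₀) = 0 := by
          have := congrFun ha'0 i; rw [ha'] at this; simpa using this
        rcases mul_eq_zero.1 h with h | h
        · exact h
        · exact absurd (sub_eq_zero.1 h) (fun h' => Fin.succ_ne_zero i (hx h'))
      have ha0 : a 0 ≠ 0 := by
        intro h0; apply ha; funext i
        rcases Fin.eq_zero_or_eq_succ i with rfl | ⟨j, rfl⟩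
        · exact h0
        · exact hcoef j
      obtain ⟨z, hz⟩ := Finset.nonempty_iff_ne_empty.2 hZe
      have := hvanp z hz 0 (hposp z hz)
      rw [iteratedDeriv_zero, hf] at this
      simp only [expSum] at this
      rw [Fin.sum_univ_succ] at this
      simp only [hcoef, zero_mul, Finset.sum_const_zero, add_zero] at this
      rcases mul_eq_zero.1 this with h | h
      · exact ha0 h
      · exact (Real.exp_pos _).ne' h
    -- Rolle points for `φ = e^{−x₀ t} f` between consecutive zeros
    let e : Fin (n + 1) ↪o ℝ := Zp.orderEmbOfFin hn
    have hφ : ∀ t, HasDerivAt (fun t => Real.exp (-x₀ * t) * f t) (Real.exp (-x₀ * t) * g t) t := by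
      intro t
      have h1 : HasDerivAt (fun t => Real.exp (-x₀ * t)) (Real.exp (-x₀ * t) * -x₀) t := by
        simpa using ((hasDerivAt_id t).const_mul (-x₀)).exp
      have h2 : HasDerivAt f (expSum (fun i => a i * x i) x t) t := hasDerivAt_expSum a x t
      refine (h1.mul h2).congr_deriv ?_
      rw [hg, hf]
      simp only [expSum, Finset.mul_sum]
      rw [← Finset.sum_add_distrib]
      exact Finset.sum_congr rfl fun i _ => by ring
    obtain ⟨c, hcmono, hcbetween, hc0⟩ := Bubbling.rolle_count_fin hφ e e.strictMono (fun i => by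
      have hz := Zp.orderEmbOfFin_mem hn i
      have := hvanp _ hz 0 (hposp _ hz)
      rw [iteratedDeriv_zero] at this
      show Real.exp (-x₀ * e i) * f (e i) = 0
      rw [this, mul_zero])
    have hgc : ∀ k, g (c k) = 0 := fun k => by
      have := hc0 k
      rcases mul_eq_zero.1 this with h | h
      · exact absurd h (Real.exp_pos _).ne'
      · exact h
    set R : Finset ℝ := Finset.univ.image c with hR
    have hRZ : Disjoint Zp R := by
      rw [Finset.disjoint_right]
      intro w hw hwZ
      obtain ⟨k, -, rfl⟩ := Finset.mem_image.1 hw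
      obtain ⟨i, hi⟩ : ∃ i, e i = c k := by
        have : c k ∈ Set.range e := by rw [Finset.range_orderEmbOfFin]; exact hwZ
        exact this
      have h1 := (hcbetween k).1; have h2 := (hcbetween k).2
      rw [← hi] at h1 h2
      have i1 : k.castSucc < i := e.lt_iff_lt.1 h1
      have i2 : i < k.succ := e.lt_iff_lt.1 h2
      rw [Fin.lt_def, Fin.val_castSucc] at i1; rw [Fin.lt_def, Fin.val_succ] at i2; omega
    have hRcard : R.card = n := by
      rw [hR, Finset.card_image_of_injective _ hcmono.injective, Finset.card_univ, Fintype.card_fin]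
    -- the new multiplicity data for `g`
    let m' : ℝ → ℕ := fun w => if w ∈ Zp then m w - 1 else 1
    have hvan' : ∀ w ∈ Zp ∪ R, ∀ k < m' w, iteratedDeriv k (expSum a' x') w = 0 := by
      intro w hw k hk
      rw [← hgx', hg, iteratedDeriv_expSum_shift]
      rcases Finset.mem_union.1 hw with hwZ | hwR
      · simp only [m', if_pos hwZ] at hk
        rw [hvanp w hwZ (k + 1) (by omega), hvanp w hwZ k (by omega), mul_zero, sub_zero]
      · have hwZ : w ∉ Zp := Finset.disjoint_right.1 hRZ hwR
        simp only [m', if_neg hwZ] at hk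
        have hk0 : k = 0 := by omega
        subst hk0
        obtain ⟨k', -, rfl⟩ := Finset.mem_image.1 hwR
        rw [iteratedDeriv_one, iteratedDeriv_zero, (hasDerivAt_expSum a x (c k')).deriv]
        have := hgc k'
        simp only [hg, expSum] at this ⊢
        rw [← this]
        simp only [Finset.mul_sum, ← Finset.sum_sub_distrib]
        exact Finset.sum_congr rfl fun i _ => by ring
    have hIH := ih x' hx' a' ha'0 (Zp ∪ R) m' hvan'
    rw [Finset.sum_union hRZ] at hIH
    have h1 : ∑ w ∈ Zp, m' w = ∑ w ∈ Zp, (m w - 1) := Finset.sum_congr rfl fun w hw => by simp only [m', if_pos hw]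
    have h2 : ∑ w ∈ R, m' w = R.card := by
      rw [Finset.card_eq_sum_ones]
      exact Finset.sum_congr rfl fun w hw => by simp only [m', if_neg (Finset.disjoint_right.1 hRZ hw)]
    rw [h1, h2, hRcard] at hIH
    -- Σ (m − 1) + n ≤ K with |Zp| = n + 1 and m ≥ 1 on Zp ⇒ Σ m ≤ K + 1
    have h3 : ∑ w ∈ Zp, (m w - 1) + Zp.card = ∑ w ∈ Zp, m w := by
      rw [Finset.card_eq_sum_ones, ← Finset.sum_add_distrib]
      exact Finset.sum_congr rfl fun w hw => by have := hposp w hw; omega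
    omega

/-- A sum over a finset enumerated increasingly: `∑_{x ∈ W} g x = ∑_i g (W.orderEmbOfFin h i)`. [folklore] -/
theorem sum_orderEmbOfFin_real {α : Type*} [LinearOrder α] (W : Finset α) {q : ℕ} (h : W.card = q) (g : α → ℝ) :
    ∑ i : Fin q, g (W.orderEmbOfFin h i) = ∑ x ∈ W, g x := by
  classical
  conv_rhs => rw [← Finset.map_orderEmbOfFin_univ W h]
  rw [Finset.sum_map]
  rfl

/-- **Laguerre–Descartes with multiplicity, coincident exponents allowed.**  For any real exponential sum `Σ_i a_i e^{x_i t}` whose regrouped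
form is non-trivial (some exponent class has non-zero coefficient sum), the total vanishing order on any finite set is at most
`#(distinct exponents) − 1`. [folklore] -/
theorem sum_order_lt_card_classes {ι : Type*} [Fintype ι] [DecidableEq ℝ] (a x : ι → ℝ)
    (hA : ∃ w, Bubbling.classSum a x w ≠ 0) (Z : Finset ℝ) (m : ℝ → ℕ)
    (hvan : ∀ z ∈ Z, ∀ k < m z, iteratedDeriv k (expSum a x) z = 0) :
    ∑ z ∈ Z, m z + 1 ≤ (Finset.univ.image x).card := by
  classical
  set T : Finset ℝ := Finset.univ.image x with hT
  obtain ⟨w₀, hw₀⟩ := hA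
  have hw₀T : w₀ ∈ T := by
    by_contra hnot
    apply hw₀
    refine Finset.sum_eq_zero fun i _ => ?_
    rw [if_neg]
    exact fun h => hnot (h ▸ Finset.mem_image_of_mem x (Finset.mem_univ i))
  obtain ⟨K, hK⟩ : ∃ K, T.card = K + 1 := ⟨T.card - 1, by have := Finset.card_pos.2 ⟨w₀, hw₀T⟩; omega⟩
  let X : Fin (K + 1) ↪o ℝ := T.orderEmbOfFin hK
  let A : Fin (K + 1) → ℝ := fun k => Bubbling.classSum a x (X k)
  have hfun : expSum a x = expSum A X := by
    funext t
    rw [Bubbling.expSum_eq_sum_classes]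
    show ∑ w ∈ T, Real.exp (w * t) * Bubbling.classSum a x w = ∑ k, A k * Real.exp (X k * t)
    rw [← sum_orderEmbOfFin_real T hK (fun w => Real.exp (w * t) * Bubbling.classSum a x w)]
    exact Finset.sum_congr rfl fun k _ => by simp only [A]; ring
  have hAne : A ≠ 0 := by
    obtain ⟨k₀, hk₀⟩ : ∃ k, X k = w₀ := by
      have : w₀ ∈ Set.range X := by rw [Finset.range_orderEmbOfFin]; exact hw₀T
      exact this
    intro h; apply hw₀; have := congrFun h k₀; simp only [A, hk₀, Pi.zero_apply] at this; exact this
  have := sum_order_le_of_expSum K X X.injective A hAne Z m (fun z hz k hk => by rw [← hfun]; exact hvan z hz k hk)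
  omega

end Summit.ValiantsHypothesis.ValiantsHypothesis.Theorems.LacunarySymmetroidMatrixDescartes.WallBubbling
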